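import Mathlib
import HarnessLib
import Summits.ResolutionOfSingularities.ResolutionOfSingularities.Theorems.WildQuotientsWildQuotientResolutionS1aA1Move2
import Summits.ResolutionOfSingularities.ResolutionOfSingularities.Theorems.WildQuotientsWildQuotientResolutionS1aD4Move3Ring
import Summits.ResolutionOfSingularities.ResolutionOfSingularities.Theorems.WildQuotientsWildQuotientResolutionS1aD4Move3Cover

/-!
# S1a — INSTANCE I-3 (D₄): MOVE 3 OF MT-D₄ (v1.1) over an ABSTRACT model of the node of the `[z′]` chart, with the exposed node of the residual chart `[Y]₂`

[OURS · L1 W4.5c · lead-1 g13; plan-1 RULING R-F15e (I-3 move-by-move in the I-2 architecture), X-CERT v1.1 §2 / v1.2-D4ROWS move 3 «centre (X₀″:2, x₂:1);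
N(x₂) KILLED (J̃(x₃) = 1), [X₀″]₂ RESIDUAL», NOTES `D4 TREE OF RECORD`; pattern of ✓`…S1aA1Move2` (`a1_move2`)] — NOT statements of the manuscript; counted 0;
AI-level work, weaker than expert review. Crux stmt-ResolutionOfSingularities-17941 `CyclicQuotientFourfolds`, line `s1a-logminvertex` v13 (`stub_reachLowerInFX`).

* ★★★ `GameFrame.GModel.d4_move3` — `M₁` a separated model (the realisation of move 2), `W` a stable affine chart (the `[z′]` chart) with node `DW` modelled by
  `Φ : DW.B ≃+* P` (`τ = Φ⁻¹σΦ` with the move-3 rows of ✓`…S1aD4Move3Ring`: `τX₁ = X₁ + stY`, `τx₃ = x₃ − stX₁Zw`, `τw = w + s²tY`; `t, s, Y, Z`, the cover unit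
  `V₀` (inverse `Vi`) and `Gfix` fixed; `X₁`, `Z` units; K1′ for `(Y, w)` and the degrees as HYPOTHESES), an atlas `𝔄₁` with `F ⊆ W`, and a closedness family
  `(Uᵢ, uᵢ)` covering `M₁.V ∖ W` with `Φ(e uᵢ) ∈ 𝒥ₙᵢ`: then `(Y:2, w:1)` is an ADMISSIBLE move and EVERY realisation `π₂ : M₂ → M₁` carries an atlas `𝔄₂` with
  `F_𝔄₂ ⊆ W₂ = [Y]₂` (the norm chart `N(w)` is KILLED: `W′ ∈ 𝔞₃` by ✓`d4m3_residual_mem`, so its cover element `c₁ = ∏(W′ + i s²t·Y′s₃)^{2dd₃} ∈ 𝔞₃`),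
  together with the EXPOSED NODE of `W₂`: `Γ(M₂, W₂) ≃+* (chart-node grading)₀` of the producer node `(ChartRing, chartNodeGrading, sigmaChart)` over `P`, its
  tameness / intertwining / chart-transition pin, the cover `M₂ = W₂ ∪ W₂′ ∪ π₂⁻¹(⋃ Uᵢ)` and the ratio section `u₂ = c₁/c₀` (a unit on `W₂ ∩ W₂′`).
-/

set_option linter.dupNamespace false

noncomputable section

open CategoryTheory Limits AlgebraicGeometry TopologicalSpace Topology Opposite
open Literature.AlgebraicGeometry.Resolution Literature.AlgebraicGeometry.RelativeSpec
open scoped LaurentPolynomial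
open Summit.ResolutionOfSingularities.ResolutionOfSingularities.Theorems.WildQuotientResolution.S1
open Summit.ResolutionOfSingularities.ResolutionOfSingularities.Theorems.WildQuotientResolution.S1.NodeAtlas
open Summit.ResolutionOfSingularities.ResolutionOfSingularities.Theorems.WildQuotientResolution.S1.CoarseChart
open Summit.ResolutionOfSingularities.ResolutionOfSingularities.Theorems.WildQuotientResolution.S1.ProducerStep
open Summit.ResolutionOfSingularities.ResolutionOfSingularities.Theorems.WildQuotientResolution.S1.NpFrame
open Summit.ResolutionOfSingularities.ResolutionOfSingularities.Theorems.WildQuotientResolution.S1.GoodCharts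
open Summit.ResolutionOfSingularities.ResolutionOfSingularities.Theorems.WildQuotientResolution.S1.BlowupCharts
open Summit.ResolutionOfSingularities.ResolutionOfSingularities.Theorems.WildQuotientResolution.S1.KillableTransport
open Summit.ResolutionOfSingularities.ResolutionOfSingularities.Theorems.WildQuotientResolution.S1.KillCert
open Summit.ResolutionOfSingularities.ResolutionOfSingularities.Theorems.WildQuotientResolution.S1.ReesBigrading
open Summit.ResolutionOfSingularities.ResolutionOfSingularities.Theorems.WildQuotientResolution.S1.NodeTransport
open Summit.ResolutionOfSingularities.ResolutionOfSingularities.Theorems.WildQuotientResolution.S1.CobordantTransport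
open Summit.ResolutionOfSingularities.ResolutionOfSingularities.Theorems.WildQuotientResolution.BlowupExit
open Summit.ResolutionOfSingularities.ResolutionOfSingularities.Theorems.WildQuotientResolution.S1.KillGlue

/-! ## Move 2 of MT-a1″ -/

namespace Summit.ResolutionOfSingularities.ResolutionOfSingularities.Theorems.WildQuotientResolution.S1.GameFrame.GModel

open MvPolynomial

variable {p : ℕ} {X' X₁ : Scheme.{0}} {q : X' ⟶ X₁} {G : Type} [Group G] {ρ : G →* Aut X'} {g₀ : G}

set_option maxHeartbeats 1600000 in
/-- ★★★ **MOVE 3 OF MT-D₄ (abstract model of the node of `[z′]`), with the exposed node of the residual chart `[Y]₂`.** See the module docstring.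
[OURS · L1 W4.5c · R-F15e I-3, move 3 of 4; NOT a statement of the manuscript] -/
theorem d4_move3 [Finite G] [NeZero p] (hp : p.Prime) (hG : ∀ g : G, g ∈ Subgroup.zpowers g₀)
    (M₁ : GModel p q G ρ g₀) [M₁.V.IsSeparated] (W : M₁.act.StableAffineOpens) (DW : NodeData p M₁.act g₀ W)
    {P : Type} [CommRing P] [CharP P p] (Φ : letI := DW.instCommRing; DW.B ≃+* P) (τ : P ≃+* P)
    (hτ : letI := DW.instCommRing; ∀ x : P, τ x = Φ (DW.σ (Φ.symm x)))
    -- generators of the model, the cover unit, and the rows of `τ`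
    (t s Y X₁ Z x₃ w Vi V₀ : P) (Gfix : Set P)
    (ht : τ t = t) (hs : τ s = s) (hY : τ Y = Y) (hZ : τ Z = Z) (hX₁ : τ X₁ = X₁ + s * t * Y) (hx₃ : τ x₃ = x₃ - s * t * X₁ * Z * w)
    (hw : τ w = w + s ^ 2 * t * Y) (hV₀ : τ V₀ = V₀) (hVV : Vi * V₀ = 1)
    (hfix : ∀ g ∈ Gfix, τ g = g) (hgen : Subring.closure (({t, s, Y, X₁, Z, x₃, w} : Set P) ∪ Gfix) = ⊤) (hX₁u : IsUnit X₁) (hZu : IsUnit Z)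
    -- degrees in the transported grading
    (θ : Π j : Fin DW.m, ZMod (DW.r j)) (d : ℕ) (hd : 0 < d)
    (hYd : letI := DW.instCommRing; letI := DW.instGradedRing; Y ∈ mapGrading DW.𝒜 Φ θ)
    (hwd : letI := DW.instCommRing; letI := DW.instGradedRing; w ∈ mapGrading DW.𝒜 Φ 0)
    (hδd : letI := DW.instCommRing; letI := DW.instGradedRing; s ^ 2 * t * Y ∈ mapGrading DW.𝒜 Φ 0)
    (hy₀d : letI := DW.instCommRing; letI := DW.instGradedRing; Y ^ (d * p) * V₀ ∈ mapGrading DW.𝒜 Φ 0)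
    -- K1′ for the centre `(Y, w)`
    (hK1 : RingTheory.Sequence.IsRegular P (List.ofFn (![Y, w] : Fin 2 → P)))
    (hK1' : IsRegularRing (P ⧸ Ideal.span (Set.range (![Y, w] : Fin 2 → P))))
    -- the closedness datum on `M₁`: a cover and separating sections with values in the filtration
    {ι : Type} (U : ι → M₁.V.Opens) (hcov : ∀ x : M₁.V, x ∈ W.1 ∨ ∃ i, x ∈ U i) (u : ι → Γ(M₁.V, W.1)) (nu : ι → ℕ) (hnu : ∀ i, 0 < nu i)
    (hu : letI := DW.instCommRing; letI := DW.instGradedRing; ∀ i,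
      Φ ((DW.e (u i) : ↥(DW.𝒜 0)) : DW.B) ∈ (weightedFiltration (![Y, w] : Fin 2 → P) ![2, 1]).ideal (nu i))
    (huU : ∀ i, ∀ v ∈ W.1, v ∈ U i → v ∈ M₁.V.basicOpen (u i))
    (𝔄₁ : NodeAtlasData p M₁.act g₀) (hF₁ : 𝔄₁.fLocus ⊆ (W.1 : Set M₁.V)) :
    letI := DW.instCommRing; letI := DW.instGradedRing; letI := mapGradedRing DW.𝒜 Φ
    ∃ (𝒦₂ : ReesFiltration M₁.V) (d₂ : ℕ), 0 < d₂ ∧ IsAdmissibleCentre p M₁.act g₀ 𝒦₂ d₂ ∧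
      ∀ (M₂ : GModel p q G ρ g₀) (π₂ : M₂.V ⟶ M₁.V), IsBlowup π₂ (𝒦₂.ideal d₂) → M₂.r = π₂ ≫ M₁.r →
        (∀ g : G, (M₂.act.aut g).hom ≫ π₂ = π₂ ≫ (M₁.act.aut g).hom) →
        ∃ (W₂ : M₂.act.StableAffineOpens) (𝔄₂ : NodeAtlasData p M₂.act g₀) (_ : 𝔄₂.fLocus ⊆ (W₂.1 : Set M₂.V))
          (_ : IsAffineOpen W₂.1) (hle : W₂.1 ≤ π₂ ⁻¹ᵁ W.1)
          -- the exposed node of `W₂ = [Y]₂`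
          (hf₂ : ∀ i, (![Y, w] : Fin 2 → P) i ∈ mapGrading DW.𝒜 Φ ((![θ, 0] : Fin 2 → Π j : Fin DW.m, ZMod (DW.r j)) i))
          (hσJ₂ : ∀ n : ℕ, ((weightedFiltration (![Y, w] : Fin 2 → P) ![2, 1]).ideal n).map (τ : P →+* P) ≤
            (weightedFiltration (![Y, w] : Fin 2 → P) ![2, 1]).ideal n)
          (hσp : ∀ x : P, (⇑τ)^[p] x = x)
          (y₀ : ↥(mapGrading DW.𝒜 Φ 0)) (_ : (y₀ : P) = (Y ^ (d * p) * V₀) ^ d₂)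
          (hy₀ : y₀ ∈ (traceFiltration (mapGrading DW.𝒜 Φ) (![Y, w] : Fin 2 → P) ![2, 1]).ideal (d₂ * (d * (2 * p))))
          (hσy₀ : τ (y₀ : P) = y₀)
          (c₁ : ↥(cobordantAlgebra (![Y, w] : Fin 2 → P) ![2, 1]))
          (_ : (c₁ : P[T;T⁻¹]) = LaurentPolynomial.C ((∏ i : ZMod p, (w + (i.val : P) * (s ^ 2 * t * Y))) ^ (2 * d * d₂)) *
            LaurentPolynomial.T (((d₂ * (d * (2 * p)) : ℕ)) : ℤ))
          (E₂ : letI := chartNodeGradedRing DW.r (mapGrading DW.𝒜 Φ) (![Y, w] : Fin 2 → P) ![2, 1] hf₂ (d₂ * (d * (2 * p))) y₀ hy₀;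
            Γ(M₂.V, W₂.1) ≃+* ↥(chartNodeGrading DW.r (mapGrading DW.𝒜 Φ) (![Y, w] : Fin 2 → P) ![2, 1] hf₂ (d₂ * (d * (2 * p))) y₀ hy₀ 0))
          (W₂' : M₂.V.Opens) (u₂ : Γ(M₂.V, W₂.1)),
          letI := chartNodeGradedRing DW.r (mapGrading DW.𝒜 Φ) (![Y, w] : Fin 2 → P) ![2, 1] hf₂ (d₂ * (d * (2 * p))) y₀ hy₀
          IsTameNode p (ChartRing (mapGrading DW.𝒜 Φ) (![Y, w] : Fin 2 → P) ![2, 1] (d₂ * (d * (2 * p))) y₀ hy₀)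
              (chartNodeGrading DW.r (mapGrading DW.𝒜 Φ) (![Y, w] : Fin 2 → P) ![2, 1] hf₂ (d₂ * (d * (2 * p))) y₀ hy₀)
              (sigmaChart (mapGrading DW.𝒜 Φ) (![Y, w] : Fin 2 → P) ![2, 1] (d₂ * (d * (2 * p))) y₀ hy₀ τ hσJ₂ hp.pos hσp hσy₀) ∧
            (∀ t' : Γ(M₂.V, W₂.1),
              ((E₂ ((M₂.act.aut g₀⁻¹).hom.appLE W₂.1 W₂.1 (W₂.2.1 g₀⁻¹).ge t') :
                  ↥(chartNodeGrading DW.r (mapGrading DW.𝒜 Φ) (![Y, w] : Fin 2 → P) ![2, 1] hf₂ (d₂ * (d * (2 * p))) y₀ hy₀ 0)) :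
                  ChartRing (mapGrading DW.𝒜 Φ) (![Y, w] : Fin 2 → P) ![2, 1] (d₂ * (d * (2 * p))) y₀ hy₀) =
                sigmaChart (mapGrading DW.𝒜 Φ) (![Y, w] : Fin 2 → P) ![2, 1] (d₂ * (d * (2 * p))) y₀ hy₀ τ hσJ₂ hp.pos hσp hσy₀
                  ((E₂ t' : ↥(chartNodeGrading DW.r (mapGrading DW.𝒜 Φ) (![Y, w] : Fin 2 → P) ![2, 1] hf₂ (d₂ * (d * (2 * p))) y₀ hy₀ 0)) :
                    ChartRing (mapGrading DW.𝒜 Φ) (![Y, w] : Fin 2 → P) ![2, 1] (d₂ * (d * (2 * p))) y₀ hy₀)) ∧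
            (∀ x : Γ(M₁.V, W.1),
              ((E₂ (π₂.appLE W.1 W₂.1 hle x) :
                  ↥(chartNodeGrading DW.r (mapGrading DW.𝒜 Φ) (![Y, w] : Fin 2 → P) ![2, 1] hf₂ (d₂ * (d * (2 * p))) y₀ hy₀ 0)) :
                  ChartRing (mapGrading DW.𝒜 Φ) (![Y, w] : Fin 2 → P) ![2, 1] (d₂ * (d * (2 * p))) y₀ hy₀) =
                toChartRing (mapGrading DW.𝒜 Φ) (![Y, w] : Fin 2 → P) ![2, 1] (d₂ * (d * (2 * p))) y₀ hy₀ ((DW.e.trans (zeroRingEquiv DW.𝒜 Φ)) x)) ∧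
            (∀ x : M₂.V, x ∈ W₂.1 ∨ x ∈ W₂' ∨ ∃ i, π₂.base x ∈ U i) ∧
            ((E₂ u₂ : ↥(chartNodeGrading DW.r (mapGrading DW.𝒜 Φ) (![Y, w] : Fin 2 → P) ![2, 1] hf₂ (d₂ * (d * (2 * p))) y₀ hy₀ 0)) :
                ChartRing (mapGrading DW.𝒜 Φ) (![Y, w] : Fin 2 → P) ![2, 1] (d₂ * (d * (2 * p))) y₀ hy₀) =
              algebraMap _ (ChartRing (mapGrading DW.𝒜 Φ) (![Y, w] : Fin 2 → P) ![2, 1] (d₂ * (d * (2 * p))) y₀ hy₀) c₁ *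
                IsLocalization.Away.invSelf (coverElement (mapGrading DW.𝒜 Φ) (![Y, w] : Fin 2 → P) ![2, 1] (d₂ * (d * (2 * p))) y₀ hy₀) ∧
            (∀ v ∈ W₂.1, v ∈ W₂' → v ∈ M₂.V.basicOpen u₂) := by
  classical
  letI := DW.instCommRing
  letI := DW.instGradedRing
  letI := mapGradedRing DW.𝒜 Φ
  have hp1 : p ≠ 1 := hp.one_lt.ne'
  have hdp : 0 < d * p := Nat.mul_pos hd hp.pos
  have hdbar : 0 < d * (2 * p) := Nat.mul_pos hd (Nat.mul_pos two_pos hp.pos)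
  have hw' : ∀ i, 0 < (![2, 1] : Fin 2 → ℕ) i := fun i => by fin_cases i <;> norm_num
  -- the transported node, read through `τ`
  have hτeq : (conj Φ DW.σ : P ≃+* P) = τ := RingEquiv.ext fun x => (hτ x).symm
  have htameτ : IsTameNode p P (mapGrading DW.𝒜 Φ) τ := hτeq ▸ isTameNode_map DW.𝒜 Φ p DW.σ DW.tame
  have hσp : ∀ x : P, (⇑τ)^[p] x = x := htameτ.2.2.2.2.2
  have hσL : ∀ t' : Γ(M₁.V, W.1), (((DW.e.trans (zeroRingEquiv DW.𝒜 Φ)) ((M₁.act.aut g₀⁻¹).hom.appLE W.1 W.1 (W.2.1 g₀⁻¹).ge t') :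
      ↥(mapGrading DW.𝒜 Φ 0)) : P) = τ (((DW.e.trans (zeroRingEquiv DW.𝒜 Φ)) t' : ↥(mapGrading DW.𝒜 Φ 0)) : P) := fun t' => by
    change Φ ((DW.e (actO M₁.act W g₀ t') : ↥(DW.𝒜 0)) : DW.B) = τ (Φ ((DW.e t' : ↥(DW.𝒜 0)) : DW.B))
    rw [DW.intertwine t', hτ, Φ.symm_apply_apply]
  have hf₂ := D4.d4m3_hf Y w DW.r (mapGrading DW.𝒜 Φ) θ hYd hwd
  have hσJ₂ := D4.d4m3_map_le τ t s Y X₁ Z x₃ w Gfix ht hs hY hZ hX₁ hx₃ hw hfix hgen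
  have hσJc : ∀ n : ℕ, ((weightedFiltration (![Y, w] : Fin 2 → P) ![2, 1]).ideal n).map (conj Φ DW.σ : P →+* P) ≤
      (weightedFiltration (![Y, w] : Fin 2 → P) ![2, 1]).ideal n := by rw [hτeq]; exact hσJ₂
  -- closedness of the traces from the separating sections
  have hcl₂ : ∀ n : ℕ, 0 < n →
      closure (M₁.V.zeroLocus (U := W.1)
          ((((traceFiltration (mapGrading DW.𝒜 Φ) (![Y, w] : Fin 2 → P) ![2, 1]).ideal n).comap
              ((DW.e.trans (zeroRingEquiv DW.𝒜 Φ) : Γ(M₁.V, W.1) ≃+* ↥(mapGrading DW.𝒜 Φ 0)) : Γ(M₁.V, W.1) →+* ↥(mapGrading DW.𝒜 Φ 0)) :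
            Ideal Γ(M₁.V, W.1)) : Set Γ(M₁.V, W.1)) ∩ (W.1 : Set M₁.V)) ⊆ (W.1 : Set M₁.V) := by
    intro n hn
    refine closure_zeroLocus_inter_subset_of_cover W.1 U hcov _ u (fun i => ⟨n, hn, ?_⟩) huU
    change (DW.e.trans (zeroRingEquiv DW.𝒜 Φ)) (u i ^ n) ∈ (traceFiltration (mapGrading DW.𝒜 Φ) (![Y, w] : Fin 2 → P) ![2, 1]).ideal n
    rw [mem_traceFiltration_iff, map_pow, SetLike.GradeZero.coe_pow]
    change (Φ ((DW.e (u i) : ↥(DW.𝒜 0)) : DW.B)) ^ n ∈ _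
    have h := Ideal.pow_mem_pow (hu i) n
    have hle := Veronese.idealFiltration_pow_le (weightedFiltration (![Y, w] : Fin 2 → P) ![2, 1]) (nu i) n
    exact (weightedFiltration (![Y, w] : Fin 2 → P) ![2, 1]).antitone (Nat.le_mul_of_pos_left n (hnu i)) (hle h)
  -- ### the centre of move 2
  obtain ⟨𝒦₂, d₂, hd₂, hadm₂, -, hG𝒦₂, h𝒦₂O, hver₂, hsupp₂⟩ := exists_isAdmissibleCentre_of_node hG M₁ W DW Φ two_pos (![Y, w] : Fin 2 → P)
    (![θ, 0]) ![2, 1] hw' hf₂ hK1 hK1' hσJc hcl₂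
  refine ⟨𝒦₂, d₂, hd₂, hadm₂, fun M₂ π₂ hbl₂ hr₂ hcomm₂ => ?_⟩
  -- ### the realisation `M₂`: cover, (H1), residual, atlas
  have hdeg0 : (Y ^ (d * p) * V₀) ^ d₂ ∈ mapGrading DW.𝒜 Φ 0 := D4.d4m3_cover_zero_deg Y V₀ d d₂ DW.r (mapGrading DW.𝒜 Φ) hy₀d
  have hdeg1 : (∏ i : ZMod p, (w + (i.val : P) * (s ^ 2 * t * Y))) ^ (2 * d * d₂) ∈ mapGrading DW.𝒜 Φ 0 := by
    have h := SetLike.pow_mem_graded (2 * d * d₂) (D4.d4m3_norm_deg (p := p) t s Y w DW.r (mapGrading DW.𝒜 Φ) hwd hδd)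
    rwa [smul_zero] at h
  obtain ⟨y', hy'0, hy'1⟩ : ∃ y' : Fin 2 → ↥(mapGrading DW.𝒜 Φ 0), y' 0 = ⟨_, hdeg0⟩ ∧ y' 1 = ⟨_, hdeg1⟩ := ⟨![⟨_, hdeg0⟩, ⟨_, hdeg1⟩], rfl, rfl⟩
  have hy'v0 : ((y' 0 : ↥(mapGrading DW.𝒜 Φ 0)) : P) = (Y ^ (d * p) * V₀) ^ d₂ := congrArg Subtype.val hy'0
  have hy'v1 : ((y' 1 : ↥(mapGrading DW.𝒜 Φ 0)) : P) = (∏ i : ZMod p, (w + (i.val : P) * (s ^ 2 * t * Y))) ^ (2 * d * d₂) := congrArg Subtype.val hy'1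
  have hy' : ∀ j, y' j ∈ (traceFiltration (mapGrading DW.𝒜 Φ) (![Y, w] : Fin 2 → P) ![2, 1]).ideal (d₂ * (d * (2 * p))) := by
    intro j
    rw [mem_traceFiltration_iff]
    fin_cases j
    · exact (congrArg (fun x : P => x ∈ (weightedFiltration (![Y, w] : Fin 2 → P) ![2, 1]).ideal (d₂ * (d * (2 * p)))) hy'v0).mpr
        (D4.d4m3_cover_zero_mem Y w V₀ d d₂)
    · exact (congrArg (fun x : P => x ∈ (weightedFiltration (![Y, w] : Fin 2 → P) ![2, 1]).ideal (d₂ * (d * (2 * p)))) hy'v1).mpr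
        (D4.d4m3_cover_one_mem t s Y w d d₂)
  have hσy' : ∀ j, τ (y' j : P) = y' j := by
    intro j
    fin_cases j
    · exact (congrArg τ hy'v0).trans ((D4.d4m3_cover_zero_fixed τ Y V₀ hY hV₀ d d₂).trans hy'v0.symm)
    · exact (congrArg τ hy'v1).trans ((D4.d4m3_cover_one_fixed τ t s Y w ht hs hY hw d d₂ hp1).trans hy'v1.symm)
  have hc0' : ((coverElement (mapGrading DW.𝒜 Φ) (![Y, w] : Fin 2 → P) ![2, 1] (d₂ * (d * (2 * p))) (y' 0) (hy' 0) :
      ↥(cobordantAlgebra (![Y, w] : Fin 2 → P) ![2, 1])) : P[T;T⁻¹]) =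
      LaurentPolynomial.C ((Y ^ (d * p) * V₀) ^ d₂) * LaurentPolynomial.T (((d₂ * (d * (2 * p)) : ℕ)) : ℤ) :=
    (coe_coverElement (mapGrading DW.𝒜 Φ) (![Y, w] : Fin 2 → P) ![2, 1] (d₂ * (d * (2 * p))) (y' 0) (hy' 0)).trans
      (congrArg (fun x : P => LaurentPolynomial.C x * LaurentPolynomial.T (((d₂ * (d * (2 * p)) : ℕ)) : ℤ)) hy'v0)
  have hc1' : ((coverElement (mapGrading DW.𝒜 Φ) (![Y, w] : Fin 2 → P) ![2, 1] (d₂ * (d * (2 * p))) (y' 1) (hy' 1) :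
      ↥(cobordantAlgebra (![Y, w] : Fin 2 → P) ![2, 1])) : P[T;T⁻¹]) =
      LaurentPolynomial.C ((∏ i : ZMod p, (w + (i.val : P) * (s ^ 2 * t * Y))) ^ (2 * d * d₂)) * LaurentPolynomial.T (((d₂ * (d * (2 * p)) : ℕ)) : ℤ) :=
    (coe_coverElement (mapGrading DW.𝒜 Φ) (![Y, w] : Fin 2 → P) ![2, 1] (d₂ * (d * (2 * p))) (y' 1) (hy' 1)).trans
      (congrArg (fun x : P => LaurentPolynomial.C x * LaurentPolynomial.T (((d₂ * (d * (2 * p)) : ℕ)) : ℤ)) hy'v1)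
  have hrad' : ∀ i : Fin 2, cobordantAlgebra.u' (![Y, w] : Fin 2 → P) ![2, 1] i ∈
      (Ideal.span (Set.range fun j => coverElement (mapGrading DW.𝒜 Φ) (![Y, w] : Fin 2 → P) ![2, 1] (d₂ * (d * (2 * p))) (y' j) (hy' j))).radical := by
    intro i
    have h := D4.d4m3_hrad t s Y w Vi V₀ hVV d d₂ (coverElement (mapGrading DW.𝒜 Φ) (![Y, w] : Fin 2 → P) ![2, 1] (d₂ * (d * (2 * p))) (y' 0) (hy' 0))
      (coverElement (mapGrading DW.𝒜 Φ) (![Y, w] : Fin 2 → P) ![2, 1] (d₂ * (d * (2 * p))) (y' 1) (hy' 1)) hc0' hc1' i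
    refine Ideal.radical_mono (Ideal.span_mono ?_) h
    exact Set.insert_subset_iff.mpr ⟨⟨0, rfl⟩, Set.singleton_subset_iff.mpr ⟨1, rfl⟩⟩
  -- (H1) and the residual ideal `𝔞₂ ∋ X₁ Y₂`
  have hH1 := D4.d4m3_augmentationIdeal_sigmaR_le τ t s Y X₁ Z x₃ w Gfix ht hs hY hZ hX₁ hx₃ hw hfix hgen hp.pos hσp
  obtain ⟨hres2, -, hres3⟩ := D4.d4m3_residual_mem τ t s Y X₁ Z x₃ w Gfix ht hs hY hZ hX₁ hx₃ hw hfix hgen hp.pos hσp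
  rw [← map_mul] at hres3
  have hY₂mem : cobordantAlgebra.u' (![Y, w] : Fin 2 → P) ![2, 1] 1 ∈
      (augmentationIdeal (sigmaR τ (![Y, w] : Fin 2 → P) ![2, 1] hσJ₂ hp.pos hσp)).colon
        (Ideal.span {algebraMap P ↥(cobordantAlgebra (![Y, w] : Fin 2 → P) ![2, 1]) (s * t) * cobordantAlgebra.s (![Y, w] : Fin 2 → P) ![2, 1]}) :=
    (Ideal.unit_mul_mem_iff_mem _ ((hX₁u.mul hZu).map (algebraMap P ↥(cobordantAlgebra (![Y, w] : Fin 2 → P) ![2, 1])))).mp hres3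
  -- the second cover element lies in `𝔞₂` (every factor of the norm does)
  have hc1prod := D4.d4m3_coverElement_one_eq t s Y w d d₂
    (coverElement (mapGrading DW.𝒜 Φ) (![Y, w] : Fin 2 → P) ![2, 1] (d₂ * (d * (2 * p))) (y' 1) (hy' 1)) hc1'
  have hfac : ∀ j : ZMod p, cobordantAlgebra.u' (![Y, w] : Fin 2 → P) ![2, 1] 1 +
      algebraMap P ↥(cobordantAlgebra (![Y, w] : Fin 2 → P) ![2, 1]) ((j.val : P) * (s ^ 2 * t)) *
        (cobordantAlgebra.s (![Y, w] : Fin 2 → P) ![2, 1] * cobordantAlgebra.u' (![Y, w] : Fin 2 → P) ![2, 1] 0) ∈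
      (augmentationIdeal (sigmaR τ (![Y, w] : Fin 2 → P) ![2, 1] hσJ₂ hp.pos hσp)).colon
        (Ideal.span {algebraMap P ↥(cobordantAlgebra (![Y, w] : Fin 2 → P) ![2, 1]) (s * t) * cobordantAlgebra.s (![Y, w] : Fin 2 → P) ![2, 1]}) := by
    intro j
    refine add_mem hY₂mem (Ideal.mul_mem_left _ _ ?_)
    have h := hres2
    rw [mul_comm (cobordantAlgebra.u' (![Y, w] : Fin 2 → P) ![2, 1] 0)] at h
    exact h
  have hprodmem : (∏ j : ZMod p, (cobordantAlgebra.u' (![Y, w] : Fin 2 → P) ![2, 1] 1 +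
      algebraMap P ↥(cobordantAlgebra (![Y, w] : Fin 2 → P) ![2, 1]) ((j.val : P) * (s ^ 2 * t)) *
        (cobordantAlgebra.s (![Y, w] : Fin 2 → P) ![2, 1] * cobordantAlgebra.u' (![Y, w] : Fin 2 → P) ![2, 1] 0))) ∈
      (augmentationIdeal (sigmaR τ (![Y, w] : Fin 2 → P) ![2, 1] hσJ₂ hp.pos hσp)).colon
        (Ideal.span {algebraMap P ↥(cobordantAlgebra (![Y, w] : Fin 2 → P) ![2, 1]) (s * t) * cobordantAlgebra.s (![Y, w] : Fin 2 → P) ![2, 1]}) := by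
    rw [← Finset.mul_prod_erase Finset.univ _ (Finset.mem_univ (0 : ZMod p))]
    exact Ideal.mul_mem_right _ _ (hfac 0)
  have hc1mem : coverElement (mapGrading DW.𝒜 Φ) (![Y, w] : Fin 2 → P) ![2, 1] (d₂ * (d * (2 * p))) (y' 1) (hy' 1) ∈
      (augmentationIdeal (sigmaR τ (![Y, w] : Fin 2 → P) ![2, 1] hσJ₂ hp.pos hσp)).colon
        (Ideal.span {algebraMap P ↥(cobordantAlgebra (![Y, w] : Fin 2 → P) ![2, 1]) (s * t) * cobordantAlgebra.s (![Y, w] : Fin 2 → P) ![2, 1]}) := by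
    rw [hc1prod]
    exact Ideal.pow_mem_of_mem _ hprodmem _ (Nat.mul_pos (Nat.mul_pos two_pos hd) hd₂)
  -- the atlas of move 2
  obtain ⟨OW₂, hOW₂aff, hOW₂eq, E₂, htame₂, hE₂, hpin₂, 𝔄₂, hF₂⟩ := exists_moveAtlas_of_node hp.pos hG M₁ M₂ 𝔄₁ W DW.affine
    DW.r (mapGrading DW.𝒜 Φ) (![Y, w] : Fin 2 → P) ![2, 1] hf₂ τ (DW.e.trans (zeroRingEquiv DW.𝒜 Φ)) htameτ hσp hσL hw' hK1 hK1' hσJ₂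
    𝒦₂ d₂ hG𝒦₂ h𝒦₂O hver₂ hsupp₂ π₂ hbl₂ hr₂ hcomm₂ hdbar y' hy' hσy' hrad'
    (algebraMap P ↥(cobordantAlgebra (![Y, w] : Fin 2 → P) ![2, 1]) (s * t) * cobordantAlgebra.s (![Y, w] : Fin 2 → P) ![2, 1]) hH1 (fun _ => 1)
    (fun j => ![algebraMap _ (ChartRing (mapGrading DW.𝒜 Φ) (![Y, w] : Fin 2 → P) ![2, 1] (d₂ * (d * (2 * p))) (y' j) (hy' j))
        (coverElement (mapGrading DW.𝒜 Φ) (![Y, w] : Fin 2 → P) ![2, 1] (d₂ * (d * (2 * p))) (y' 1) (hy' 1)) *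
      IsLocalization.Away.invSelf (coverElement (mapGrading DW.𝒜 Φ) (![Y, w] : Fin 2 → P) ![2, 1] (d₂ * (d * (2 * p))) (y' j) (hy' j))])
    (fun j l => by
      fin_cases l
      exact residualSection_mem_chartNodeGrading_zero DW.r (mapGrading DW.𝒜 Φ) (![Y, w] : Fin 2 → P) ![2, 1] hf₂ (y' j) (hy' j)
        (coverElement_mem_reesPiece (mapGrading DW.𝒜 Φ) (![Y, w] : Fin 2 → P) ![2, 1] (d₂ * (d * (2 * p))) (y' 1) (hy' 1)))
    (fun j l => by
      fin_cases l
      exact residualSection_mem_map DW.r (mapGrading DW.𝒜 Φ) (![Y, w] : Fin 2 → P) ![2, 1] (y' j) (hy' j) hc1mem)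
  have hWle : ∀ j, (OW₂ j).1 ≤ π₂ ⁻¹ᵁ W.1 := fun j => by rw [hOW₂eq j]; exact blowupChart_le_preimage π₂ _ ⟨W.1, DW.affine⟩ _
  -- the `N₂` chart is killed: its residual section is `1`
  have hz1W : ∀ v ∈ (OW₂ 1).1, v ∈ M₂.V.basicOpen
      (letI := chartNodeGradedRing DW.r (mapGrading DW.𝒜 Φ) (![Y, w] : Fin 2 → P) ![2, 1] hf₂ (d₂ * (d * (2 * p))) (y' 1) (hy' 1);
        (E₂ 1).symm ⟨_, residualSection_mem_chartNodeGrading_zero DW.r (mapGrading DW.𝒜 Φ) (![Y, w] : Fin 2 → P) ![2, 1] hf₂ (y' 1) (hy' 1)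
          (coverElement_mem_reesPiece (mapGrading DW.𝒜 Φ) (![Y, w] : Fin 2 → P) ![2, 1] (d₂ * (d * (2 * p))) (y' 1) (hy' 1))⟩) := fun v hv => by
    letI := chartNodeGradedRing DW.r (mapGrading DW.𝒜 Φ) (![Y, w] : Fin 2 → P) ![2, 1] hf₂ (d₂ * (d * (2 * p))) (y' 1) (hy' 1)
    have h1 : (⟨_, residualSection_mem_chartNodeGrading_zero DW.r (mapGrading DW.𝒜 Φ) (![Y, w] : Fin 2 → P) ![2, 1] hf₂ (y' 1) (hy' 1)
          (coverElement_mem_reesPiece (mapGrading DW.𝒜 Φ) (![Y, w] : Fin 2 → P) ![2, 1] (d₂ * (d * (2 * p))) (y' 1) (hy' 1))⟩ :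
        ↥((chartNodeGrading DW.r (mapGrading DW.𝒜 Φ) (![Y, w] : Fin 2 → P) ![2, 1] hf₂ (d₂ * (d * (2 * p))) (y' 1) (hy' 1)) 0)) = 1 :=
      Subtype.ext (IsLocalization.Away.mul_invSelf _)
    rw [h1, map_one, Scheme.basicOpen_of_isUnit _ isUnit_one]
    exact hv
  have hF₂W : 𝔄₂.fLocus ⊆ ((OW₂ 0).1 : Set M₂.V) := by
    intro v hv
    rcases hF₂ hv with hold | hnew
    · exact absurd (hF₁ hold.1) hold.2
    · obtain ⟨j, hvW, hvR⟩ := Set.mem_iUnion.mp hnew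
      revert hvW hvR
      refine Fin.cases ?_ (fun j' => Fin.cases ?_ (fun j'' => j''.elim0) j') j
      · intro hvW _
        exact hvW
      · intro hvW hvR
        exact absurd (hz1W v hvW) (hvR 0)
  -- ### the exposed node of `W₂ = OW₂ 0`: cover of `M₂.V` and the ratio section
  have hπ' : IsBlowup π₂ ((𝒦₂.ideal d₂) ^ (d * (2 * p))) := isBlowup_pow hbl₂ hdbar.ne'
  have hverbar := CoarseChart.veroneseNormalised_mul (mapGrading DW.𝒜 Φ) _ _ hver₂ hdbar
  have hJ' : ((𝒦₂.ideal d₂) ^ (d * (2 * p))).ideal ⟨W.1, DW.affine⟩ =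
      ((traceFiltration (mapGrading DW.𝒜 Φ) (![Y, w] : Fin 2 → P) ![2, 1]).ideal (d₂ * (d * (2 * p)))).comap
        ((DW.e.trans (zeroRingEquiv DW.𝒜 Φ) : Γ(M₁.V, W.1) ≃+* ↥(mapGrading DW.𝒜 Φ 0)) : Γ(M₁.V, W.1) →+* ↥(mapGrading DW.𝒜 Φ 0)) := by
    rw [Scheme.IdealSheafData.ideal_pow, Pi.pow_apply, ← ReesFiltration.filtration_ideal, h𝒦₂O d₂, hver₂.2 (d * (2 * p)), comap_equiv_pow]
  have hxJ0 : (DW.e.trans (zeroRingEquiv DW.𝒜 Φ)).symm (y' 0) ∈ ((𝒦₂.ideal d₂) ^ (d * (2 * p))).ideal ⟨W.1, DW.affine⟩ := by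
    rw [hJ', Ideal.mem_comap, RingHom.coe_coe, RingEquiv.apply_symm_apply]; exact hy' 0
  have hcov₂ : ∀ x : M₂.V, x ∈ (OW₂ 0).1 ∨ x ∈ (OW₂ 1).1 ∨ ∃ i, π₂.base x ∈ U i := by
    intro x
    rcases hcov (π₂.base x) with hxW | hxU
    · have hcovW := iSup_blowupChart_eq_preimage (I := 𝒦₂.ideal d₂) M₁.act DW.r (mapGrading DW.𝒜 Φ) (![Y, w] : Fin 2 → P) ![2, 1] hf₂
        W DW.affine (DW.e.trans (zeroRingEquiv DW.𝒜 Φ)) hπ' hverbar hJ' y' hy' hrad'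
      have hx : x ∈ ⨆ j, blowupChart π₂ ((𝒦₂.ideal d₂) ^ (d * (2 * p))) ⟨W.1, DW.affine⟩ ((DW.e.trans (zeroRingEquiv DW.𝒜 Φ)).symm (y' j)) :=
        (congrArg (fun U : M₂.V.Opens => x ∈ U) hcovW).mpr hxW
      obtain ⟨j, hj⟩ := Opens.mem_iSup.mp hx
      revert hj
      refine Fin.cases ?_ (fun j' => Fin.cases ?_ (fun j'' => j''.elim0) j') j
      · intro hj; exact Or.inl ((congrArg (fun U : M₂.V.Opens => x ∈ U) (hOW₂eq 0)).mpr hj)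
      · intro hj; exact Or.inr (Or.inl ((congrArg (fun U : M₂.V.Opens => x ∈ U) (hOW₂eq 1)).mpr hj))
    · exact Or.inr (Or.inr hxU)
  -- the ratio section `u₂ = E₂⁻¹(c₁/c₀)` on `W₂` and its pin
  letI inst0 := chartNodeGradedRing DW.r (mapGrading DW.𝒜 Φ) (![Y, w] : Fin 2 → P) ![2, 1] hf₂ (d₂ * (d * (2 * p))) (y' 0) (hy' 0)
  have hz0mem := residualSection_mem_chartNodeGrading_zero DW.r (mapGrading DW.𝒜 Φ) (![Y, w] : Fin 2 → P) ![2, 1] hf₂ (y' 0) (hy' 0)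
    (coverElement_mem_reesPiece (mapGrading DW.𝒜 Φ) (![Y, w] : Fin 2 → P) ![2, 1] (d₂ * (d * (2 * p))) (y' 1) (hy' 1))
  have hpz : (E₂ 0).symm ⟨_, hz0mem⟩ * π₂.appLE W.1 (OW₂ 0).1 (hWle 0) ((DW.e.trans (zeroRingEquiv DW.𝒜 Φ)).symm (y' 0)) =
      π₂.appLE W.1 (OW₂ 0).1 (hWle 0) ((DW.e.trans (zeroRingEquiv DW.𝒜 Φ)).symm (y' 1)) :=
    symm_mul_appLE_eq_of_pin π₂ W.1 (OW₂ 0).1 (hWle 0)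
      (chartNodeGrading DW.r (mapGrading DW.𝒜 Φ) (![Y, w] : Fin 2 → P) ![2, 1] hf₂ (d₂ * (d * (2 * p))) (y' 0) (hy' 0)) (E₂ 0)
      (DW.e.trans (zeroRingEquiv DW.𝒜 Φ)) (toChartRing (mapGrading DW.𝒜 Φ) (![Y, w] : Fin 2 → P) ![2, 1] (d₂ * (d * (2 * p))) (y' 0) (hy' 0))
      (hpin₂ 0 (hWle 0)) ⟨_, hz0mem⟩ _ _ (y' 1) (y' 0) (RingEquiv.apply_symm_apply _ _) (RingEquiv.apply_symm_apply _ _)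
      (coverRatio_mul_toChartRing (mapGrading DW.𝒜 Φ) (![Y, w] : Fin 2 → P) ![2, 1] (d₂ * (d * (2 * p))) (y' 0) (y' 1) (hy' 0) (hy' 1))
  have hu₂ : ∀ v ∈ (OW₂ 0).1, v ∈ (OW₂ 1).1 → v ∈ M₂.V.basicOpen ((E₂ 0).symm ⟨_, hz0mem⟩) := fun v hv0 hv1 =>
    mem_basicOpen_of_mem_blowupChart_of_mul_appLE_eq hπ' ⟨W.1, DW.affine⟩ hxJ0 (le_of_eq (hOW₂eq 0)) _ hpz hv0
      ((congrArg (fun U : M₂.V.Opens => v ∈ U) (hOW₂eq 1)).mp hv1)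
  refine ⟨OW₂ 0, 𝔄₂, hF₂W, hOW₂aff 0, hWle 0, hf₂, hσJ₂, hσp, y' 0, hy'v0, hy' 0, hσy' 0,
    coverElement (mapGrading DW.𝒜 Φ) (![Y, w] : Fin 2 → P) ![2, 1] (d₂ * (d * (2 * p))) (y' 1) (hy' 1), hc1', E₂ 0, (OW₂ 1).1,
    (E₂ 0).symm ⟨_, hz0mem⟩, htame₂ 0, hE₂ 0, hpin₂ 0 (hWle 0), hcov₂, ?_, hu₂⟩
  rw [(E₂ 0).apply_symm_apply]

end Summit.ResolutionOfSingularities.ResolutionOfSingularities.Theorems.WildQuotientResolution.S1.GameFrame.GModel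

end
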